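import Summits.CriticalPhenomena.Ising3DConformalLimit.Theorems.MonotoneBlockingMonotoneBlockingTwoKarlinDefs
import HarnessLib

/-!
# Stub `convolution1D` of line `Sketch` (karlin-scale-tp2) for crux `MonotoneBlockingTwo` (stmt-CriticalPhenomena-17054)

The one-dimensional lattice→continuum convolution identity: for a measurable `φ : ℝ → ℝ≥0∞`,
`L ≥ 1` and `κ ∈ ℤ`,

`Σ_{x,y ∈ [0,L)} ∫_{[0,1)}∫_{[0,1)} φ(Lκ + x + u − y − v) du dv = L² ∫ T(s − κ) φ(L s) ds`,

where `T = tent` is the unit tent. Proof: the double cube sum of unit-cell integrals tiles the square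
`[0,L)²` (translation invariance of Lebesgue measure and induction on `L`); the substitution `Y = X − D`
and Tonelli reduce the square integral to `∫ φ(Lκ + D) · vol([0,L) ∩ [D, D+L)) dD = ∫ φ(Lκ + D) (L − |D|)₊ dD`;
finally the affine change of variables `D = L (s − κ)` (`Real.map_volume_mul_left`) gives the tent form.
Everything is an identity of lower Lebesgue integrals in `ℝ≥0∞`, so only measurability of `φ` is used
(to interchange a finite sum with an integral and for Tonelli).
-/

noncomputable section

namespace Summit.CriticalPhenomena.Ising3DConformalLimit.Cruxes.MonotoneBlockingTwo.KarlinScaleTP2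

open MeasureTheory Set
open scoped BigOperators ENNReal

/-! ## Reindexing and tiling -/

/-- Reindexing the integer interval `[0,L) ∩ ℤ` by `Finset.range L`. -/
private theorem sum_Ico_int (f : ℤ → ℝ≥0∞) (L : ℕ) :
    ∑ x ∈ Finset.Ico (0:ℤ) L, f x = ∑ i ∈ Finset.range L, f i := by
  rw [Int.Ico_eq_finset_map, Finset.sum_map]
  simp

/-- Translation: the unit-cell integral of `ψ (a + ·)` is the integral of `ψ` over `[a, a+1)`. -/
private theorem lintegral_unitCell_translate (ψ : ℝ → ℝ≥0∞) (a : ℝ) :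
    ∫⁻ u in Ico (0:ℝ) 1, ψ (a + u) = ∫⁻ w in Ico a (a + 1), ψ w := by
  rw [← lintegral_indicator measurableSet_Ico, ← lintegral_indicator measurableSet_Ico,
    ← lintegral_add_left_eq_self ((Ico a (a + 1)).indicator ψ) a]
  refine lintegral_congr (fun u => ?_)
  by_cases hu : u ∈ Ico (0:ℝ) 1
  · rw [indicator_of_mem hu,
      indicator_of_mem (show a + u ∈ Ico a (a + 1) from ⟨by linarith [hu.1], by linarith [hu.2]⟩)]
  · rw [indicator_of_notMem hu,
      indicator_of_notMem
        (show a + u ∉ Ico a (a + 1) from fun h => hu ⟨by linarith [h.1], by linarith [h.2]⟩)]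

/-- Tiling: `∑_{i<n} ∫_{[0,1)} ψ(i + u) du = ∫_{[0,n)} ψ`. -/
private theorem sum_lintegral_unitCell (ψ : ℝ → ℝ≥0∞) (n : ℕ) :
    ∑ i ∈ Finset.range n, ∫⁻ u in Ico (0:ℝ) 1, ψ (i + u) = ∫⁻ w in Ico (0:ℝ) n, ψ w := by
  induction n with
  | zero => simp
  | succ n ih =>
    rw [Finset.sum_range_succ, ih, lintegral_unitCell_translate ψ n, Nat.cast_succ,
      ← lintegral_union measurableSet_Ico Ico_disjoint_Ico_same,
      Ico_union_Ico_eq_Ico (Nat.cast_nonneg (α := ℝ) n) (by linarith : (n:ℝ) ≤ (n:ℝ) + 1)]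

/-- The double cube sum of unit-cell integrals is the integral over the square `[0,L)²`. -/
private theorem blockSum_eq_sqIntegral (φ : ℝ → ℝ≥0∞) (hφ : Measurable φ) (c : ℝ) (L : ℕ) :
    ∑ i ∈ Finset.range L, ∑ j ∈ Finset.range L,
        ∫⁻ u in Ico (0:ℝ) 1, ∫⁻ v in Ico (0:ℝ) 1, φ (c + i + u - j - v) =
      ∫⁻ X in Ico (0:ℝ) L, ∫⁻ Y in Ico (0:ℝ) L, φ (c + X - Y) := by
  calc ∑ i ∈ Finset.range L, ∑ j ∈ Finset.range L,
          ∫⁻ u in Ico (0:ℝ) 1, ∫⁻ v in Ico (0:ℝ) 1, φ (c + i + u - j - v)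
      = ∑ i ∈ Finset.range L, ∫⁻ u in Ico (0:ℝ) 1, ∑ j ∈ Finset.range L,
          ∫⁻ v in Ico (0:ℝ) 1, φ (c + i + u - j - v) := by
        refine Finset.sum_congr rfl (fun i _ => ?_)
        rw [lintegral_finsetSum]
        intro j _
        exact (hφ.comp
          (by fun_prop : Measurable fun p : ℝ × ℝ => c + i + p.1 - j - p.2)).lintegral_prod_right'
    _ = ∑ i ∈ Finset.range L, ∫⁻ u in Ico (0:ℝ) 1, ∫⁻ Y in Ico (0:ℝ) L, φ (c + i + u - Y) := by
        refine Finset.sum_congr rfl (fun i _ => lintegral_congr (fun u => ?_))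
        have h := sum_lintegral_unitCell (fun Y => φ (c + i + u - Y)) L
        simp only [← sub_sub] at h
        exact h
    _ = ∫⁻ X in Ico (0:ℝ) L, ∫⁻ Y in Ico (0:ℝ) L, φ (c + X - Y) := by
        have h := sum_lintegral_unitCell (fun X => ∫⁻ Y in Ico (0:ℝ) L, φ (c + X - Y)) L
        simp only [← add_assoc] at h
        exact h

/-! ## The square integral: substitution `Y = X - D` and Tonelli -/

/-- `∫_{[0,l)}∫_{[0,l)} φ(c + X − Y) dY dX = ∫ (l − |D|)₊ φ(c + D) dD`. -/
private theorem sqIntegral_eq (φ : ℝ → ℝ≥0∞) (hφ : Measurable φ) (c l : ℝ) :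
    ∫⁻ X in Ico (0:ℝ) l, ∫⁻ Y in Ico (0:ℝ) l, φ (c + X - Y) =
      ∫⁻ D, ENNReal.ofReal (l - |D|) * φ (c + D) := by
  -- inner substitution `Y = X - D`
  have h1 : ∀ X : ℝ, ∫⁻ Y in Ico (0:ℝ) l, φ (c + X - Y) =
      ∫⁻ D, (Ico (0:ℝ) l).indicator (1 : ℝ → ℝ≥0∞) (X - D) * φ (c + D) := by
    intro X
    rw [← lintegral_indicator measurableSet_Ico,
      ← lintegral_sub_left_eq_self
        (fun D => (Ico (0:ℝ) l).indicator (1 : ℝ → ℝ≥0∞) (X - D) * φ (c + D)) X]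
    refine lintegral_congr (fun Y => ?_)
    rw [sub_sub_cancel]
    by_cases hY : Y ∈ Ico (0:ℝ) l
    · rw [indicator_of_mem hY, indicator_of_mem hY, Pi.one_apply, one_mul]
      congr 1
      ring
    · rw [indicator_of_notMem hY, indicator_of_notMem hY, zero_mul]
  -- joint measurability of the substituted integrand
  have hF : Measurable (Function.uncurry fun (X D : ℝ) =>
      (Ico (0:ℝ) l).indicator (1 : ℝ → ℝ≥0∞) (X - D) * φ (c + D)) :=
    ((measurable_one.indicator measurableSet_Ico).comp (measurable_fst.sub measurable_snd)).mul
      (hφ.comp (measurable_snd.const_add c))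
  -- the `X`-section has measure `(l - |D|)₊`
  have h3 : ∀ D : ℝ, ∫⁻ X in Ico (0:ℝ) l, (Ico (0:ℝ) l).indicator (1 : ℝ → ℝ≥0∞) (X - D) =
      ENNReal.ofReal (l - |D|) := by
    intro D
    have hpt : ∀ X : ℝ, (Ico (0:ℝ) l).indicator (1 : ℝ → ℝ≥0∞) (X - D) =
        (Ico D (D + l)).indicator 1 X := by
      intro X
      by_cases h : X ∈ Ico D (D + l)
      · rw [indicator_of_mem h,
          indicator_of_mem (show X - D ∈ Ico (0:ℝ) l from ⟨by linarith [h.1], by linarith [h.2]⟩),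
          Pi.one_apply, Pi.one_apply]
      · rw [indicator_of_notMem h,
          indicator_of_notMem (show X - D ∉ Ico (0:ℝ) l from
            fun h' => h ⟨by linarith [h'.1], by linarith [h'.2]⟩)]
    simp_rw [hpt]
    rw [lintegral_indicator_one measurableSet_Ico, Measure.restrict_apply measurableSet_Ico,
      Ico_inter_Ico, Real.volume_Ico]
    congr 1
    rcases le_total 0 D with hD | hD
    · rw [abs_of_nonneg hD, max_eq_left hD, min_eq_right (by linarith)]
    · rw [abs_of_nonpos hD, max_eq_right hD, min_eq_left (by linarith)]
      ring
  simp_rw [h1]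
  rw [lintegral_lintegral_swap hF.aemeasurable]
  refine lintegral_congr (fun D => ?_)
  rw [lintegral_mul_const, h3, mul_comm]
  exact (measurable_one.indicator measurableSet_Ico).comp (measurable_sub_const D)

/-! ## Rescaling `D = a (s - κ)` -/

/-- Linear change of variables `D = a t` (`a > 0`) on `ℝ` for the lower Lebesgue integral
(no measurability needed). -/
private theorem lintegral_comp_mul_pos (G : ℝ → ℝ≥0∞) {a : ℝ} (ha : 0 < a) :
    ∫⁻ D, G D = ENNReal.ofReal a * ∫⁻ t, G (a * t) := by
  -- adapted from Literature.Analysis.Complex.ExtremalLength.lintegral_comp_mul_left_of_pos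
  have h1 : ∫⁻ t, G (a * t) = ∫⁻ D, G D ∂(Measure.map (fun t ↦ a * t) volume) := by
    rw [show (fun t ↦ a * t) = ⇑(Homeomorph.mulLeft₀ a ha.ne').toMeasurableEquiv from rfl,
      lintegral_map_equiv]
    rfl
  rw [h1, Real.map_volume_mul_left ha.ne', lintegral_smul_measure, smul_eq_mul,
    abs_of_pos (inv_pos.2 ha), ← mul_assoc, ← ENNReal.ofReal_mul ha.le, mul_inv_cancel₀ ha.ne',
    ENNReal.ofReal_one, one_mul]

/-- `ofReal (a − |a t|) = a · ofReal (tent t)` for `a > 0`. -/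
private theorem ofReal_sub_abs_mul {a : ℝ} (ha : 0 < a) (t : ℝ) :
    ENNReal.ofReal (a - |a * t|) = ENNReal.ofReal a * ENNReal.ofReal (tent t) := by
  rw [tent, abs_mul, abs_of_pos ha, ← ENNReal.ofReal_mul ha.le]
  rcases le_total 0 (1 - |t|) with h | h
  · rw [max_eq_right h]
    congr 1
    ring
  · rw [max_eq_left h, mul_zero, ENNReal.ofReal_zero]
    exact ENNReal.ofReal_of_nonpos (by nlinarith [abs_nonneg t])

/-- The affine rescaling `D = a (s − κ)`:
`∫ (a − |D|)₊ φ(aκ + D) dD = a² ∫ T(s − κ) φ(a s) ds`. -/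
private theorem rescale (φ : ℝ → ℝ≥0∞) (κ : ℝ) {a : ℝ} (ha : 0 < a) :
    ∫⁻ D, ENNReal.ofReal (a - |D|) * φ (a * κ + D) =
      ENNReal.ofReal a ^ 2 * ∫⁻ s, ENNReal.ofReal (tent (s - κ)) * φ (a * s) := by
  set H : ℝ → ℝ≥0∞ := fun s => ENNReal.ofReal (tent (s - κ)) * φ (a * s) with hH
  have hpt : ∀ t : ℝ, ENNReal.ofReal (a - |a * t|) * φ (a * κ + a * t) =
      ENNReal.ofReal a * H (t + κ) := by
    intro t
    simp only [hH, add_sub_cancel_right]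
    rw [ofReal_sub_abs_mul ha, mul_assoc, show a * (t + κ) = a * κ + a * t by ring]
  rw [lintegral_comp_mul_pos (fun D => ENNReal.ofReal (a - |D|) * φ (a * κ + D)) ha]
  simp_rw [hpt]
  rw [lintegral_const_mul' _ _ ENNReal.ofReal_ne_top, lintegral_add_right_eq_self, ← mul_assoc, sq]

/-! ## The stub -/

/-- **Stub `convolution1D`** — the one-dimensional lattice→continuum convolution identity: for
measurable `φ : ℝ → ℝ≥0∞`, `L ≥ 1` and `κ ∈ ℤ`,
`Σ_{x,y ∈ [0,L)} ∫_{[0,1)}∫_{[0,1)} φ(Lκ + x + u − y − v) du dv = L² ∫ T(s − κ) φ(Ls) ds`. -/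
theorem stub_convolution1D : Sig.stub_convolution1D := by
  intro φ hφ L hL κ
  have hL0 : (0:ℝ) < (L:ℝ) := Nat.cast_pos.mpr (by omega)
  simp_rw [sum_Ico_int, Int.cast_natCast]
  rw [blockSum_eq_sqIntegral φ hφ ((L:ℝ) * (κ:ℝ)) L, sqIntegral_eq φ hφ, rescale φ (κ:ℝ) hL0,
    ENNReal.ofReal_natCast]

end Summit.CriticalPhenomena.Ising3DConformalLimit.Cruxes.MonotoneBlockingTwo.KarlinScaleTP2

end
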